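import Summits.ResolutionOfSingularities.ResolutionOfSingularities.Theorems.FrobeniusClosingSteerBetaPolygonSupport
import Summits.ResolutionOfSingularities.ResolutionOfSingularities.Theorems.FrobeniusClosingSteerBetaPolygonCanonicalCleaning
import HarnessLib

/-!
# Crux `Steer` (stmt-ResolutionOfSingularities-16345), chain W4.1 — hK4ⁿᶜ β-leaf TRANSPORT BRICK, part 3:
# `BetaGe` and `BetaGt` in Cohen coordinates are SUPPORT CONDITIONS

OURS (campaign `res-hironaka`, rung L ★L-G4, slot W4.1; seat res-L0-w41-stub-4 g7 on res-L0-w41-plan-1 RULING 172a «TRANSPORT brick GO»;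
companion of `…BetaPolygonSupport` (equivariance, the generic support theorem, `alphaGe_X_iff`, `deltaGe_X_iff`)). Replaces the role of no
printed item; NOT a statement of the manuscript under review [claim: Hironaka2017, status: under-review]; AI-produced, weaker than expert
review. Theses-free, definition-free over the TREE words `BetaGe` (`…BetaPolygonWords`, p536143) and `BetaGt` (`…BetaPolygonGauge`, p540729).

With `x = X 0`, `y = X 1`, `z = X 2`, `w = X 3` in `R⟦X₀, X₁, X₂, X₃⟧` and `n := d − m 2 − m 3` (truncated):
* **`betaGe_X_iff`** (`0 ≤ α`, `0 ≤ ρ`): `BetaGe (X 0) (X 1) (X 2) (X 3) d α ρ F ↔ ∀ m, coeff m F ≠ 0 → ⌊α·n⌋₊ + 1 ≤ m 0 ∨ (⌈α·n⌉₊ ≤ m 0 ∧ ⌈ρ·n⌉₊ ≤ m 1)`;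
* **`betaGt_X_iff`** (`0 ≤ α`, `0 ≤ β`): `BetaGt (X 0) (X 1) (X 2) (X 3) d α β F ↔ ∀ m, coeff m F ≠ 0 → d ≤ m 2 + m 3 ∨ ⌊α·n⌋₊ + 1 ≤ m 0 ∨
  (⌈α·n⌉₊ ≤ m 0 ∧ ⌊β·n⌋₊ + 1 ≤ m 1)`;
* helpers `span_beta_cell_eq`, `floor_mul_mono`, `ceil_mul_mono`, `exists_beta_cell_iff`;
* THE WORDS AFTER OPTIMAL (TWISTED) CLEANING — (C1) `…BetaPolygonCanonicalCleaning` (p543008) meets the support conditions (`R` perfect of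
  characteristic `2`): `exists_alphaGe_X_add_sq_iff` `(∃ q, AlphaGe (X 0) (X 2) (X 3) d ρ (F + q²)) ↔` every ODD monomial of `F` satisfies the
  `α`-threshold; likewise `exists_deltaGe/betaGe/betaGt_X_add_sq_iff` and the twisted forms `…_add_monomial_mul_sq_iff` (`u = X^{ν(e₀)}`),
  via `exists_add_(monomial_mul_)sq_mem_iff_of_support`.
Together with `alphaGe/deltaGe/betaGe/betaGt_map_iff` (equivariance) and part 1's `exists_ringEquiv_mvPowerSeries_four` (Cohen coordinates on
the r.s.o.p. of an `IsHatRing`-type member), every threshold word — hence `α(r), β(r), δ(r)` of ONE representative and «`β > β₀`» — is read off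
the SUPPORT of the expansion, the currency of the (C1) canonical-cleaning kernel (`…BetaPolygonCanonicalCleaning`, p543008).

[cite: CossartJannsenSaito2020, Def. 11.1] [folklore]
bears_on: LADDER-RESOLUTION L ★L-G4 W4.1 (crux `Steer`, binder hK4ⁿᶜ, transport for (C1) / brick I).
-/

noncomputable section

-- `Summit.<S>.<S>.…` duplicates the summit name by design (single-problem summit).
set_option linter.dupNamespace false

open IsLocalRing MvPowerSeries
open Summit.ResolutionOfSingularities.ResolutionOfSingularities.Theorems.SwitchingDichotomy.BetaPolygon
open Summit.ResolutionOfSingularities.ResolutionOfSingularities.Theorems.SwitchingDichotomy.CanonicalCleaning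
open Summit.ResolutionOfSingularities.ResolutionOfSingularities.Theorems.SwitchingDichotomy.PowerSeriesParity
open Literature.RingTheory.MvPowerSeries

namespace Summit.ResolutionOfSingularities.ResolutionOfSingularities.Theorems.SwitchingDichotomy.BetaPolygonMoves

section BetaInstances

variable {R : Type} [CommRing R]

/-- The `β`-cell with its `(z, w)`-monomial: `(x^a z^i w^j) + (x^c y^e z^i w^j) = (X^(single 0 a), X^(single 0 c + single 1 e)) · (z^i w^j)`. -/
theorem span_beta_cell_eq (a c e i j : ℕ) :
    Ideal.span {(X 0 : MvPowerSeries (Fin 4) R) ^ a * X 2 ^ i * X 3 ^ j} ⊔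
        Ideal.span {(X 0 : MvPowerSeries (Fin 4) R) ^ c * X 1 ^ e * X 2 ^ i * X 3 ^ j} =
      Ideal.span ((fun g => monomial g (1 : R)) ''
          ((({Finsupp.single 0 a, Finsupp.single 0 c + Finsupp.single 1 e} : Finset (Fin 4 →₀ ℕ))) : Set _)) *
        Ideal.span {(X 2 : MvPowerSeries (Fin 4) R) ^ i * X 3 ^ j} := by
  have h1 : (monomial (Finsupp.single (0 : Fin 4) a) (1 : R) : MvPowerSeries (Fin 4) R) = X 0 ^ a := (X_pow_eq _ _).symm
  have h2 : (monomial (Finsupp.single (0 : Fin 4) c + Finsupp.single 1 e) (1 : R) : MvPowerSeries (Fin 4) R) =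
      X 0 ^ c * X 1 ^ e := by
    rw [X_pow_eq, X_pow_eq, monomial_mul_monomial, one_mul]
  rw [Finset.coe_pair, Set.image_pair, h1, h2, Ideal.span_insert, Ideal.sup_mul, Ideal.span_singleton_mul_span_singleton,
    Ideal.span_singleton_mul_span_singleton, mul_assoc, mul_assoc (X 0 ^ c * X 1 ^ e)]

/-- Monotonicity of the cell thresholds in the slot (`0 ≤ α`). -/
theorem floor_mul_mono {α : ℚ} (hα : 0 ≤ α) {n k : ℕ} (h : n ≤ k) : ⌊α * (n : ℚ)⌋₊ ≤ ⌊α * (k : ℚ)⌋₊ :=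
  Nat.floor_mono (mul_le_mul_of_nonneg_left (by exact_mod_cast h) hα)

/-- Monotonicity of the cell thresholds in the slot (`0 ≤ α`). -/
theorem ceil_mul_mono {α : ℚ} (hα : 0 ≤ α) {n k : ℕ} (h : n ≤ k) : ⌈α * (n : ℚ)⌉₊ ≤ ⌈α * (k : ℚ)⌉₊ :=
  Nat.ceil_mono (mul_le_mul_of_nonneg_left (by exact_mod_cast h) hα)

/-- The threshold arithmetic behind `β`: the cell condition for some admissible slot `k` is the cell condition at the
least slot `d − s` (`0 ≤ α, ρ`). -/
theorem exists_beta_cell_iff {α ρ : ℚ} (hα : 0 ≤ α) (hρ : 0 ≤ ρ) (d s a b : ℕ) :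
    (∃ k, k ≤ d ∧ (⌊α * (k : ℚ)⌋₊ + 1 ≤ a ∨ (⌈α * (k : ℚ)⌉₊ ≤ a ∧ ⌈ρ * (k : ℚ)⌉₊ ≤ b)) ∧ d - k ≤ s) ↔
      ⌊α * ((d - s : ℕ) : ℚ)⌋₊ + 1 ≤ a ∨ (⌈α * ((d - s : ℕ) : ℚ)⌉₊ ≤ a ∧ ⌈ρ * ((d - s : ℕ) : ℚ)⌉₊ ≤ b) := by
  constructor
  · rintro ⟨k, hkd, hk, hks⟩
    have hnk : d - s ≤ k := by omega
    rcases hk with hk | ⟨hk1, hk2⟩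
    · exact Or.inl ((Nat.add_le_add_right (floor_mul_mono hα hnk) 1).trans hk)
    · exact Or.inr ⟨(ceil_mul_mono hα hnk).trans hk1, (ceil_mul_mono hρ hnk).trans hk2⟩
  · intro h
    exact ⟨d - s, Nat.sub_le d s, h, by omega⟩

/-- **`β ≥ ρ` on the column `a = α` IN COHEN COORDINATES** (`0 ≤ α`, `0 ≤ ρ`): `BetaGe (X 0) (X 1) (X 2) (X 3) d α ρ F` iff every monomial
`m` of `F` lies strictly right of the column (`⌊α n⌋ + 1 ≤ m 0`) or on/right of it and not below `ρ` (`⌈α n⌉ ≤ m 0 ∧ ⌈ρ n⌉ ≤ m 1`),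
`n = d − m 2 − m 3` truncated. OURS. (folklore) -/
theorem betaGe_X_iff (d : ℕ) {α ρ : ℚ} (hα : 0 ≤ α) (hρ : 0 ≤ ρ) (F : MvPowerSeries (Fin 4) R) :
    BetaGe (X 0) (X 1) (X 2) (X 3) d α ρ F ↔
      ∀ m : Fin 4 →₀ ℕ, coeff m F ≠ 0 →
        ⌊α * ((d - m 2 - m 3 : ℕ) : ℚ)⌋₊ + 1 ≤ m 0 ∨
          (⌈α * ((d - m 2 - m 3 : ℕ) : ℚ)⌉₊ ≤ m 0 ∧ ⌈ρ * ((d - m 2 - m 3 : ℕ) : ℚ)⌉₊ ≤ m 1) := by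
  classical
  unfold BetaGe
  simp_rw [span_beta_cell_eq]
  set G : ℕ → Finset (Fin 4 →₀ ℕ) := fun k =>
    {Finsupp.single 0 (⌊α * (k : ℚ)⌋₊ + 1), Finsupp.single 0 ⌈α * (k : ℚ)⌉₊ + Finsupp.single 1 ⌈ρ * (k : ℚ)⌉₊} with hGdef
  have hC0 : Ideal.span ((fun g => monomial g (1 : R)) '' ((G 0 : Finset (Fin 4 →₀ ℕ)) : Set _)) =
      (⊤ : Ideal (MvPowerSeries (Fin 4) R)) := by
    rw [Ideal.eq_top_iff_one]
    refine Ideal.subset_span ⟨0, ?_, monomial_zero_one⟩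
    simp [hGdef]
  have key := sup_iSup_eq_iSup_mul_pow (S := MvPowerSeries (Fin 4) R)
    (C := fun k => Ideal.span ((fun g => monomial g (1 : R)) '' ((G k : Finset (Fin 4 →₀ ℕ)) : Set _))) hC0 (X 2) (X 3) d
  rw [key, mem_iSup_span_monomial_mul_pow_iff G (show (2 : Fin 4) ≠ 3 by decide) ?_ d F]
  · refine forall₂_congr fun m _ => ?_
    rw [Nat.sub_sub, ← exists_beta_cell_iff hα hρ d (m 2 + m 3) (m 0) (m 1)]
    refine exists_congr fun k => and_congr_right fun _ => ?_
    constructor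
    · rintro ⟨g, hg, hgm, hdk⟩
      simp only [hGdef, Finset.mem_insert, Finset.mem_singleton] at hg
      rcases hg with rfl | rfl
      · exact ⟨Or.inl (Finsupp.single_le_iff.mp hgm), hdk⟩
      · exact ⟨Or.inr ((single_add_single_le_iff (show (0 : Fin 4) ≠ 1 by decide) _ _ m).mp hgm), hdk⟩
    · rintro ⟨hk | hk, hdk⟩
      · exact ⟨_, by simp [hGdef], Finsupp.single_le_iff.mpr hk, hdk⟩
      · exact ⟨_, by simp [hGdef], (single_add_single_le_iff (show (0 : Fin 4) ≠ 1 by decide) _ _ m).mpr hk, hdk⟩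
  · intro k g hg
    simp only [hGdef, Finset.mem_insert, Finset.mem_singleton] at hg
    rcases hg with rfl | rfl <;> simp

/-- **`BetaGt` IN COHEN COORDINATES** (`0 ≤ α`, `0 ≤ β`): `BetaGt (X 0) (X 1) (X 2) (X 3) d α β F` («the left vertex is lexicographically
beyond `(α, β)`») iff every monomial `m` of `F` has `(z, w)`-degree `≥ d`, or lies strictly right of the column, or on/right of it and
STRICTLY above `β` (`⌊β n⌋ + 1 ≤ m 1`). OURS. (folklore) -/
theorem betaGt_X_iff (d : ℕ) {α β : ℚ} (hα : 0 ≤ α) (hβ : 0 ≤ β) (F : MvPowerSeries (Fin 4) R) :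
    BetaGt (X 0) (X 1) (X 2) (X 3) d α β F ↔
      ∀ m : Fin 4 →₀ ℕ, coeff m F ≠ 0 →
        d ≤ m 2 + m 3 ∨ ⌊α * ((d - m 2 - m 3 : ℕ) : ℚ)⌋₊ + 1 ≤ m 0 ∨
          (⌈α * ((d - m 2 - m 3 : ℕ) : ℚ)⌉₊ ≤ m 0 ∧ ⌊β * ((d - m 2 - m 3 : ℕ) : ℚ)⌋₊ + 1 ≤ m 1) := by
  classical
  unfold BetaGt
  simp_rw [span_beta_cell_eq]
  set Gp : ℕ → Finset (Fin 4 →₀ ℕ) := fun k =>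
    {Finsupp.single 0 (⌊α * (k : ℚ)⌋₊ + 1), Finsupp.single 0 ⌈α * (k : ℚ)⌉₊ + Finsupp.single 1 (⌊β * (k : ℚ)⌋₊ + 1)} with hGp
  set G : ℕ → Finset (Fin 4 →₀ ℕ) := fun k => if k = 0 then {0} else Gp k with hGdef
  have hGG : ∀ i j : ℕ, i + j < d →
      Ideal.span ((fun g => monomial g (1 : R)) '' ((Gp (d - i - j) : Finset (Fin 4 →₀ ℕ)) : Set _)) *
          Ideal.span {(X 2 : MvPowerSeries (Fin 4) R) ^ i * X 3 ^ j} =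
        Ideal.span ((fun g => monomial g (1 : R)) '' ((G (d - i - j) : Finset (Fin 4 →₀ ℕ)) : Set _)) *
          Ideal.span {(X 2 : MvPowerSeries (Fin 4) R) ^ i * X 3 ^ j} := by
    intro i j hij
    rw [hGdef]; simp only [show d - i - j ≠ 0 by omega, if_false]
  have hre : (⨆ (i : ℕ) (j : ℕ) (_ : i + j < d),
      Ideal.span ((fun g => monomial g (1 : R)) '' ((Gp (d - i - j) : Finset (Fin 4 →₀ ℕ)) : Set _)) *
        Ideal.span {(X 2 : MvPowerSeries (Fin 4) R) ^ i * X 3 ^ j}) =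
      ⨆ (i : ℕ) (j : ℕ) (_ : i + j < d),
        Ideal.span ((fun g => monomial g (1 : R)) '' ((G (d - i - j) : Finset (Fin 4 →₀ ℕ)) : Set _)) *
          Ideal.span {(X 2 : MvPowerSeries (Fin 4) R) ^ i * X 3 ^ j} :=
    iSup_congr fun i => iSup_congr fun j => iSup_congr fun hij => hGG i j hij
  rw [hre]
  have hC0 : Ideal.span ((fun g => monomial g (1 : R)) '' ((G 0 : Finset (Fin 4 →₀ ℕ)) : Set _)) =
      (⊤ : Ideal (MvPowerSeries (Fin 4) R)) := by
    rw [hGdef]; simp only [if_true, Finset.coe_singleton, Set.image_singleton, monomial_zero_one, Ideal.span_singleton_one]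
  have key := sup_iSup_eq_iSup_mul_pow (S := MvPowerSeries (Fin 4) R)
    (C := fun k => Ideal.span ((fun g => monomial g (1 : R)) '' ((G k : Finset (Fin 4 →₀ ℕ)) : Set _))) hC0 (X 2) (X 3) d
  rw [key, mem_iSup_span_monomial_mul_pow_iff G (show (2 : Fin 4) ≠ 3 by decide) ?_ d F]
  · refine forall₂_congr fun m _ => ?_
    rw [Nat.sub_sub]
    constructor
    · rintro ⟨k, hkd, g, hg, hgm, hdk⟩
      by_cases hds : d ≤ m 2 + m 3
      · exact Or.inl hds
      right
      have hk0 : k ≠ 0 := by rintro rfl; exact hds (by simpa using hdk)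
      rw [hGdef] at hg; simp only [hk0, if_false, hGp, Finset.mem_insert, Finset.mem_singleton] at hg
      have hnk : d - (m 2 + m 3) ≤ k := by omega
      rcases hg with rfl | rfl
      · exact Or.inl ((Nat.add_le_add_right (floor_mul_mono hα hnk) 1).trans (Finsupp.single_le_iff.mp hgm))
      · obtain ⟨h0, h1⟩ := (single_add_single_le_iff (show (0 : Fin 4) ≠ 1 by decide) _ _ m).mp hgm
        exact Or.inr ⟨(ceil_mul_mono hα hnk).trans h0, (Nat.add_le_add_right (floor_mul_mono hβ hnk) 1).trans h1⟩
    · intro h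
      by_cases hds : d ≤ m 2 + m 3
      · refine ⟨0, Nat.zero_le d, 0, ?_, bot_le, by simpa using hds⟩
        rw [hGdef]; simp
      have hn0 : d - (m 2 + m 3) ≠ 0 := by omega
      rcases h with hds' | hk | ⟨hk0, hk1⟩
      · exact absurd hds' hds
      · refine ⟨d - (m 2 + m 3), Nat.sub_le _ _, Finsupp.single 0 (⌊α * ((d - (m 2 + m 3) : ℕ) : ℚ)⌋₊ + 1), ?_,
          Finsupp.single_le_iff.mpr hk, by omega⟩
        rw [hGdef]; simp [hn0, hGp]
      · refine ⟨d - (m 2 + m 3), Nat.sub_le _ _,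
          Finsupp.single 0 ⌈α * ((d - (m 2 + m 3) : ℕ) : ℚ)⌉₊ + Finsupp.single 1 (⌊β * ((d - (m 2 + m 3) : ℕ) : ℚ)⌋₊ + 1), ?_,
          (single_add_single_le_iff (show (0 : Fin 4) ≠ 1 by decide) _ _ m).mpr ⟨hk0, hk1⟩, by omega⟩
        rw [hGdef]; simp [hn0, hGp]
  · intro k g hg
    rw [hGdef] at hg
    by_cases hk0 : k = 0
    · simp only [hk0, if_true, Finset.mem_singleton] at hg; subst hg; simp
    · simp only [hk0, if_false, hGp, Finset.mem_insert, Finset.mem_singleton] at hg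
      rcases hg with rfl | rfl <;> simp

end BetaInstances

/-! ## The words AFTER OPTIMAL (twisted) CLEANING: (C1) meets the support conditions

For `R` perfect of characteristic `2`, whether SOME cleaning `F + u·q²` (`u = X^{ν(e₀)}` square-free; `e₀ = 0` is plain cleaning)
satisfies a threshold word is decided by the monomials of `F` OUTSIDE the parity class `e₀` alone
(`CanonicalCleaning.exists_add_monomial_mul_sq_mem_iff`, p543008, applied to the support descriptions above). -/

section Cleaned

variable {R : Type} [CommRing R] [CharP R 2] [PerfectRing R 2]

/-- From a support description «`F ∈ I ↔` every monomial of `F` satisfies `P`» to the (C1) form and back: twisted cleaning. -/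
theorem exists_add_monomial_mul_sq_mem_iff_of_support {I : Ideal (MvPowerSeries (Fin 4) R)} {P : (Fin 4 →₀ ℕ) → Prop}
    (hI : ∀ F : MvPowerSeries (Fin 4) R, F ∈ I ↔ ∀ m, coeff m F ≠ 0 → P m) (e₀ : Fin 4 → Fin 2)
    (F : MvPowerSeries (Fin 4) R) :
    (∃ q : MvPowerSeries (Fin 4) R, F + monomial (liftExp 2 e₀) (1 : R) * q ^ 2 ∈ I) ↔
      ∀ m : Fin 4 →₀ ℕ, modExp 2 m ≠ e₀ → coeff m F ≠ 0 → P m := by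
  have hI' : ∀ F' : MvPowerSeries (Fin 4) R, F' ∈ I ↔ ∀ m ∉ {m : Fin 4 →₀ ℕ | P m}, coeff m F' = 0 := fun F' => by
    rw [hI]
    exact ⟨fun h m hm => by_contra fun hc => hm (h m hc), fun h m hc => by_contra fun hm => hc (h m hm)⟩
  refine (exists_add_monomial_mul_sq_mem_iff hI' e₀ F).trans (forall_congr' fun m => ?_)
  simp only [Set.mem_setOf_eq]
  exact ⟨fun h hme hc => by_contra fun hm => hc (h hm hme), fun h hm hme => by_contra fun hc => hm (h hme hc)⟩

/-- The same for PLAIN cleaning `F + q²`: decided by the monomials of `F` with SOME ODD exponent. -/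
theorem exists_add_sq_mem_iff_of_support {I : Ideal (MvPowerSeries (Fin 4) R)} {P : (Fin 4 →₀ ℕ) → Prop}
    (hI : ∀ F : MvPowerSeries (Fin 4) R, F ∈ I ↔ ∀ m, coeff m F ≠ 0 → P m) (F : MvPowerSeries (Fin 4) R) :
    (∃ q : MvPowerSeries (Fin 4) R, F + q ^ 2 ∈ I) ↔ ∀ m : Fin 4 →₀ ℕ, (∃ i, Odd (m i)) → coeff m F ≠ 0 → P m := by
  have hI' : ∀ F' : MvPowerSeries (Fin 4) R, F' ∈ I ↔ ∀ m ∉ {m : Fin 4 →₀ ℕ | P m}, coeff m F' = 0 := fun F' => by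
    rw [hI]
    exact ⟨fun h m hm => by_contra fun hc => hm (h m hc), fun h m hc => by_contra fun hm => hc (h m hm)⟩
  refine (exists_add_sq_mem_iff hI' F).trans (forall_congr' fun m => ?_)
  simp only [Set.mem_setOf_eq]
  exact ⟨fun h hme hc => by_contra fun hm => hc (h hm hme), fun h hm hme => by_contra fun hc => hm (h hme hc)⟩

/-- **`α` after plain cleaning**: `∃ q, AlphaGe (X 0) (X 2) (X 3) d ρ (F + q²)` iff every ODD monomial `m` of `F` has `⌈ρ·n⌉ ≤ m 0`.
OURS. (folklore) -/
theorem exists_alphaGe_X_add_sq_iff (d : ℕ) (ρ : ℚ) (F : MvPowerSeries (Fin 4) R) :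
    (∃ q : MvPowerSeries (Fin 4) R, AlphaGe (X 0) (X 2) (X 3) d ρ (F + q ^ 2)) ↔
      ∀ m : Fin 4 →₀ ℕ, (∃ i, Odd (m i)) → coeff m F ≠ 0 → ⌈ρ * ((d - m 2 - m 3 : ℕ) : ℚ)⌉₊ ≤ m 0 :=
  exists_add_sq_mem_iff_of_support (fun F' => alphaGe_X_iff d ρ F') F

/-- **`α` after twisted cleaning** (`u = X^{ν(e₀)}`). OURS. (folklore) -/
theorem exists_alphaGe_X_add_monomial_mul_sq_iff (d : ℕ) (ρ : ℚ) (e₀ : Fin 4 → Fin 2) (F : MvPowerSeries (Fin 4) R) :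
    (∃ q : MvPowerSeries (Fin 4) R, AlphaGe (X 0) (X 2) (X 3) d ρ (F + monomial (liftExp 2 e₀) (1 : R) * q ^ 2)) ↔
      ∀ m : Fin 4 →₀ ℕ, modExp 2 m ≠ e₀ → coeff m F ≠ 0 → ⌈ρ * ((d - m 2 - m 3 : ℕ) : ℚ)⌉₊ ≤ m 0 :=
  exists_add_monomial_mul_sq_mem_iff_of_support (fun F' => alphaGe_X_iff d ρ F') e₀ F

/-- **`δ` after plain cleaning.** OURS. (folklore) -/
theorem exists_deltaGe_X_add_sq_iff (d : ℕ) (ρ : ℚ) (F : MvPowerSeries (Fin 4) R) :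
    (∃ q : MvPowerSeries (Fin 4) R, DeltaGe (X 0) (X 1) (X 2) (X 3) d ρ (F + q ^ 2)) ↔
      ∀ m : Fin 4 →₀ ℕ, (∃ i, Odd (m i)) → coeff m F ≠ 0 → ⌈ρ * ((d - m 2 - m 3 : ℕ) : ℚ)⌉₊ ≤ m 0 + m 1 :=
  exists_add_sq_mem_iff_of_support (fun F' => deltaGe_X_iff d ρ F') F

/-- **`δ` after twisted cleaning.** OURS. (folklore) -/
theorem exists_deltaGe_X_add_monomial_mul_sq_iff (d : ℕ) (ρ : ℚ) (e₀ : Fin 4 → Fin 2) (F : MvPowerSeries (Fin 4) R) :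
    (∃ q : MvPowerSeries (Fin 4) R, DeltaGe (X 0) (X 1) (X 2) (X 3) d ρ (F + monomial (liftExp 2 e₀) (1 : R) * q ^ 2)) ↔
      ∀ m : Fin 4 →₀ ℕ, modExp 2 m ≠ e₀ → coeff m F ≠ 0 → ⌈ρ * ((d - m 2 - m 3 : ℕ) : ℚ)⌉₊ ≤ m 0 + m 1 :=
  exists_add_monomial_mul_sq_mem_iff_of_support (fun F' => deltaGe_X_iff d ρ F') e₀ F

/-- **`β` after plain cleaning** (`0 ≤ α`, `0 ≤ ρ`). OURS. (folklore) -/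
theorem exists_betaGe_X_add_sq_iff (d : ℕ) {α ρ : ℚ} (hα : 0 ≤ α) (hρ : 0 ≤ ρ) (F : MvPowerSeries (Fin 4) R) :
    (∃ q : MvPowerSeries (Fin 4) R, BetaGe (X 0) (X 1) (X 2) (X 3) d α ρ (F + q ^ 2)) ↔
      ∀ m : Fin 4 →₀ ℕ, (∃ i, Odd (m i)) → coeff m F ≠ 0 →
        ⌊α * ((d - m 2 - m 3 : ℕ) : ℚ)⌋₊ + 1 ≤ m 0 ∨
          (⌈α * ((d - m 2 - m 3 : ℕ) : ℚ)⌉₊ ≤ m 0 ∧ ⌈ρ * ((d - m 2 - m 3 : ℕ) : ℚ)⌉₊ ≤ m 1) :=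
  exists_add_sq_mem_iff_of_support (fun F' => betaGe_X_iff d hα hρ F') F

/-- **`β` after twisted cleaning** (`0 ≤ α`, `0 ≤ ρ`). OURS. (folklore) -/
theorem exists_betaGe_X_add_monomial_mul_sq_iff (d : ℕ) {α ρ : ℚ} (hα : 0 ≤ α) (hρ : 0 ≤ ρ) (e₀ : Fin 4 → Fin 2)
    (F : MvPowerSeries (Fin 4) R) :
    (∃ q : MvPowerSeries (Fin 4) R, BetaGe (X 0) (X 1) (X 2) (X 3) d α ρ (F + monomial (liftExp 2 e₀) (1 : R) * q ^ 2)) ↔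
      ∀ m : Fin 4 →₀ ℕ, modExp 2 m ≠ e₀ → coeff m F ≠ 0 →
        ⌊α * ((d - m 2 - m 3 : ℕ) : ℚ)⌋₊ + 1 ≤ m 0 ∨
          (⌈α * ((d - m 2 - m 3 : ℕ) : ℚ)⌉₊ ≤ m 0 ∧ ⌈ρ * ((d - m 2 - m 3 : ℕ) : ℚ)⌉₊ ≤ m 1) :=
  exists_add_monomial_mul_sq_mem_iff_of_support (fun F' => betaGe_X_iff d hα hρ F') e₀ F

/-- **`BetaGt` after plain cleaning** (`0 ≤ α`, `0 ≤ β`): «`β > β₀` is reachable by cleaning». OURS. (folklore) -/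
theorem exists_betaGt_X_add_sq_iff (d : ℕ) {α β : ℚ} (hα : 0 ≤ α) (hβ : 0 ≤ β) (F : MvPowerSeries (Fin 4) R) :
    (∃ q : MvPowerSeries (Fin 4) R, BetaGt (X 0) (X 1) (X 2) (X 3) d α β (F + q ^ 2)) ↔
      ∀ m : Fin 4 →₀ ℕ, (∃ i, Odd (m i)) → coeff m F ≠ 0 →
        d ≤ m 2 + m 3 ∨ ⌊α * ((d - m 2 - m 3 : ℕ) : ℚ)⌋₊ + 1 ≤ m 0 ∨
          (⌈α * ((d - m 2 - m 3 : ℕ) : ℚ)⌉₊ ≤ m 0 ∧ ⌊β * ((d - m 2 - m 3 : ℕ) : ℚ)⌋₊ + 1 ≤ m 1) :=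
  exists_add_sq_mem_iff_of_support (fun F' => betaGt_X_iff d hα hβ F') F

/-- **`BetaGt` after twisted cleaning** (`0 ≤ α`, `0 ≤ β`). OURS. (folklore) -/
theorem exists_betaGt_X_add_monomial_mul_sq_iff (d : ℕ) {α β : ℚ} (hα : 0 ≤ α) (hβ : 0 ≤ β) (e₀ : Fin 4 → Fin 2)
    (F : MvPowerSeries (Fin 4) R) :
    (∃ q : MvPowerSeries (Fin 4) R, BetaGt (X 0) (X 1) (X 2) (X 3) d α β (F + monomial (liftExp 2 e₀) (1 : R) * q ^ 2)) ↔
      ∀ m : Fin 4 →₀ ℕ, modExp 2 m ≠ e₀ → coeff m F ≠ 0 →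
        d ≤ m 2 + m 3 ∨ ⌊α * ((d - m 2 - m 3 : ℕ) : ℚ)⌋₊ + 1 ≤ m 0 ∨
          (⌈α * ((d - m 2 - m 3 : ℕ) : ℚ)⌉₊ ≤ m 0 ∧ ⌊β * ((d - m 2 - m 3 : ℕ) : ℚ)⌋₊ + 1 ≤ m 1) :=
  exists_add_monomial_mul_sq_mem_iff_of_support (fun F' => betaGt_X_iff d hα hβ F') e₀ F

end Cleaned


end Summit.ResolutionOfSingularities.ResolutionOfSingularities.Theorems.SwitchingDichotomy.BetaPolygonMoves

end
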